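import Literature.NumberTheory.Transcendental.BrownCoactionCalculus
import HarnessLib

/-!
# Brown, *Mixed Tate motives over ℤ* (2012) — the window calculus of (3.4) with formal
# coefficients (Brown's `∂^f`), for module-valued pairings

Sibling file of `BrownCoactionCalculus.lean`, in the cone of the named fact
`Literature.NumberTheory.Transcendental.hoffmanSpan_eq_mzvSpace` (Brown 2012, Theorem 1.1).
`BrownCoactionCalculus` analyses the windows (subsequences) of `(0; ρ(w); 1)` in Goncharov's formula
(3.4) for the `ζ_{2r+1}`-COMPONENT `D r = ((ζ_{2r+1} ↦ 1) ⊗ id) ∘ D_{2r+1} : H → H` of Brown's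
operators, with the coefficients already specialized to their values `c_{2^a32^b} = zagierCoeff a b`,
`c_{12^r} = 2(-1)^r` (Theorem 4.3, Lemma 3.8). For §§3.2–4 of the paper (Lemma 3.5, Corollary 3.6,
Theorem 4.3 — the DERIVATION of these values) one needs the same analysis for the full operator
`D_{2r+1} : H → 𝔏_{2r+1} ⊗ H` and with the left factors `π(Iᵐ(window))` kept formal, as in Brown's
formal version `∂^f` of §5.4 ("replacing the coefficient `±c_w` of `π(Iᵐ(γ))` with its formal
representative `±C_w`"). This file provides exactly that, once and for all, for an arbitrary
`ℚ`-bilinear pairing `B r : H × H → T r` in place of `(h, y) ↦ f r (h) • y`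
(`Brown2012.WindowData`; the full coaction is the case `B r h y = π_r(h) ⊗ y`, `T r = 𝔏_{2r+1} ⊗ H`):

* `WindowData.lhs_sub_rhs_mem` — for `w ∈ {2,3}^×`, `r ≥ 1` and any prefix `x`:
  `∑_{windows} B r (Iᵐ(window)) (ζᵐ(x·quotient))`
  `≡ ∑_{w = uvy, deg₃ v = 1, |v| = 2r+1} (B r ζᵐ(v) - [y ≠ ∅] B r ζᵐ(ṽ)) (ζᵐ(xuy))`
  `  + ∑_{w = u 3 2^r y} B r ζᵐ₁(2^r) (ζᵐ(xu2y)) - ∑_{w = u 2^r 3 y} B r ζᵐ₁(2^r) (ζᵐ(xu2y))`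
  modulo the `B r h (ζᵐ(xu'))`, `deg₃ u' ≤ deg₃ w - 2` (`ζᵐ₁(2^r) = Iᵐ(0; 0ρ(2^r); 1)`) — the proof
  of Theorem 6.1 / Lemma 5.6 with formal coefficients (types (2), (3), the neighbour pairing by I3,
  vanishing by I0), by induction on `w` exactly as in `BrownCoactionCalculus`;
* `WindowData.lhs_eq_rhs_of_level_le_one` — for `deg₃ w ≤ 1` nothing is neglected: an exact
  formula (the shape of **Lemma 3.5**, `D_{2r+1} ζᵐ(2^a 3 2^b) = π(ξ^r_{a,b}) ⊗ ζᵐ(2^{a+b+1-r})`);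
* `WindowData.lhs_eq_zero_of_level_eq_zero` — **Lemma 3.4**: all windows of `(0; (10)^n; 1)` vanish;
* `CoactionData.toWindowData` — the scalar case, and the consistency check
  `CoactionData.rhs_toWindowData` (specializing the formal coefficients by (3.12)/(4.2)/Lemma 3.8
  recovers `CoactionData.rhs`).

No named facts are introduced (`WindowData` is a hypothesis bundle, D-0026).

## References

* F. Brown, *Mixed Tate motives over ℤ*, Ann. of Math. **175** (2012), 949–976: §3.1 (3.4),
  Lemmas 3.4, 3.5, §5.4 (`∂^f`, `M^f`), Lemma 5.6, Theorem 6.1 (arXiv:1102.1312). [Brown2012]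
-/

namespace Literature.NumberTheory.Transcendental

namespace Brown2012

open MZV

/-! ### Window data: (3.4) with a module-valued pairing -/

/-- **Window data**: a `ℚ`-vector space `H` with `J u = Iᵐ(0; u; 1)`, target modules `T r` and
`ℚ`-bilinear pairings `B r : H × H → T r`, and operators `D r : H → T r` given on the `Iᵐ(0; v; 1)`
by Goncharov's formula **(3.4)** read through `B r`:
`D r (Iᵐ(0;v;1)) = ∑_{windows} B r (Iᵐ(a_p; a_{p+1}…a_{p+2r+1}; a_{p+2r+2})) (Iᵐ(0; quotient; 1))`.
Instances: the `ζ_{2r+1}`-component (`B r h y = f r (h) • y`, `CoactionData.toWindowData`) and the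
full `D_{2r+1} : H → 𝔏_{2r+1} ⊗ H` (`B r h y = π_r(h) ⊗ y`). [cite: Brown2012, §3.1 (3.4)] -/
structure WindowData where
  /-- Brown's space `H` of motivic multiple zeta values. -/
  H : Type
  [instAddCommGroup : AddCommGroup H]
  [instModule : Module ℚ H]
  /-- `J u = Iᵐ(0; u; 1)`. -/
  J : List Bool → H
  /-- The target of `D r` (`H`, or `𝔏_{2r+1} ⊗ H`). -/
  T : ℕ → Type
  [instT : ∀ r, AddCommGroup (T r)]
  [instTM : ∀ r, Module ℚ (T r)]
  /-- The pairing of the left factor `Iᵐ(window)` with the quotient. -/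
  B : (r : ℕ) → H →ₗ[ℚ] H →ₗ[ℚ] T r
  /-- The operator (`D_{2r+1}` or a component of it). -/
  D : (r : ℕ) → H →ₗ[ℚ] T r
  /-- (3.4) read through `B r`. -/
  coaction : ∀ r : ℕ, 1 ≤ r → ∀ v : List Bool,
    D r (J v) = ∑ p ∈ Finset.range (v.length + 1 - (2 * r + 1)),
      B r (Im J (lft v p) (inner v (2 * r + 1) p) (rgt v (2 * r + 1) p)) (J (quot v (2 * r + 1) p))

attribute [instance] WindowData.instAddCommGroup WindowData.instModule WindowData.instT
  WindowData.instTM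

namespace WindowData

variable (W : WindowData)

/-- `ζᵐ(w) = Iᵐ(0; ρ(w); 1)` (Brown's order of the arguments). [cite: Brown2012, Definition 5.2] -/
def z (w : List ℕ) : W.H := W.J (rho w)

/-- The term of the window at `p` in (3.4) read through `B r`, quotient prefixed by `ρ(x)`.
[cite: Brown2012, (3.4)] -/
def wterm (r : ℕ) (x : List ℕ) (v : List Bool) (p : ℕ) : W.T r :=
  W.B r (Im W.J (lft v p) (inner v (2 * r + 1) p) (rgt v (2 * r + 1) p))
    (W.J (rho x ++ quot v (2 * r + 1) p))

/-- The left-hand side: (3.4) for `ζᵐ(w)` with quotients prefixed by `ρ(x)` (`x = ∅` gives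
`D r (ζᵐ(w))`). [cite: Brown2012, (3.4)] -/
def lhs (r : ℕ) (x w : List ℕ) : W.T r :=
  ∑ p ∈ Finset.range ((rho w).length + 1 - (2 * r + 1)), W.wterm r x (rho w) p

/-- (3.4) for `ζᵐ(w)`: `D r (ζᵐ(w))` is the left-hand side with `x = ∅`. [cite: Brown2012, (3.4)] -/
theorem D_z_eq_lhs {r : ℕ} (hr : 1 ≤ r) (w : List ℕ) : W.D r (W.z w) = W.lhs r [] w := by
  rw [z, W.coaction r hr, lhs]
  simp [wterm]

end WindowData

namespace WindowData

variable (W : WindowData)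

/-! ### The formal right-hand side -/

/-- Contribution `Iᵐ(0;ρ(v);1) ⊠ ζᵐ(x u y)` (formal coefficient `C_v`) of the type-(3) window of the
first kind at `i` (`w = u v y`).
[cite: Brown2012, proof of Theorem 6.1, case (3)] -/
def gK1 (r : ℕ) (x w : List ℕ) (i : ℕ) : W.T r :=
  if K1 w r i then W.B r (W.J (rho (vK w r i))) (W.z (x ++ qK w r i)) else 0

/-- Contribution `ζᵐ(ṽ) ⊠ ζᵐ(x u y)` (formal `C_{ṽ}`, with the sign `-`) of its right neighbour, the
window of the second kind, present iff `y ≠ ∅`. [cite: Brown2012, proof of Theorem 6.1, case (3)] -/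
def gK2 (r : ℕ) (x w : List ℕ) (i : ℕ) : W.T r :=
  if K1 w r i ∧ i + r < w.length then W.B r (W.J (rho (vK w r i).reverse)) (W.z (x ++ qK w r i))
  else 0

/-- Contribution `ζᵐ₁(2^r) ⊠ ζᵐ(x u 2 y)` (formal `C_{12^r}`) of a type-(2) window of the first kind.
[cite: Brown2012, proof of Theorem 6.1, case (2)] -/
def gT1 (r : ℕ) (x w : List ℕ) (i : ℕ) : W.T r :=
  if T1 w r i then W.B r (W.J (false :: rho (List.replicate r 2))) (W.z (x ++ qT w r i)) else 0

/-- Contribution `ζᵐ₁(2^r) ⊠ ζᵐ(x u 2 y)` (formal `C_{12^r}`, sign `-`) of a type-(2) window of the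
second kind.
[cite: Brown2012, proof of Theorem 6.1, case (2)] -/
def gT2 (r : ℕ) (x w : List ℕ) (i : ℕ) : W.T r :=
  if T2 w r i then W.B r (W.J (false :: rho (List.replicate r 2))) (W.z (x ++ qT w r i)) else 0

/-- The word-level right-hand side with FORMAL coefficients (Brown's `∂^f_{N,ℓ}` / `M^f_{N,ℓ}` of
§5.4): all contributing windows. [cite: Brown2012, §5.4 and (5.7)] -/
def rhs (r : ℕ) (x w : List ℕ) : W.T r :=
  ∑ i ∈ Finset.range (w.length + 1), (W.gK1 r x w i - W.gK2 r x w i + W.gT1 r x w i - W.gT2 r x w i)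

/-- The span of the `h ⊠ ζᵐ(x u)` with `u` of level `≤ deg₃ w - 2` (and the right weight): the terms
neglected in `gr^F_{ℓ-1}` (proof of Lemma 5.6 / Theorem 6.1 (4)). [cite: Brown2012, Lemma 5.6] -/
def P (r : ℕ) (x w : List ℕ) : Submodule ℚ (W.T r) :=
  Submodule.span ℚ {t | ∃ h u, IsHoffman u ∧ weight u + (2 * r + 1) = weight w ∧
    level u + 2 ≤ level w ∧ t = W.B r h (W.z (x ++ u))}

/-- Generators of `P`. [folklore] -/
theorem B_z_mem_P {r : ℕ} {x w : List ℕ} (h : W.H) {u : List ℕ} (hu : IsHoffman u)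
    (hwt : weight u + (2 * r + 1) = weight w) (hl : level u + 2 ≤ level w) :
    W.B r h (W.z (x ++ u)) ∈ W.P r x w :=
  Submodule.subset_span ⟨h, u, hu, hwt, hl, rfl⟩

/-- `P` grows with the word. [folklore] -/
theorem P_append_le {r : ℕ} (x : List ℕ) {c : ℕ} {w : List ℕ} (hc : c = 2 ∨ c = 3) :
    W.P r (x ++ [c]) w ≤ W.P r x (c :: w) := by
  refine Submodule.span_le.2 ?_
  rintro _ ⟨h, u, hu, hwt, hl, rfl⟩
  rw [List.append_assoc, List.singleton_append]
  refine W.B_z_mem_P h (fun i hi => ?_) ?_ ?_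
  · simp only [List.mem_cons] at hi
    rcases hi with rfl | hi
    · exact hc
    · exact hu i hi
  · rw [weight_cons, weight_cons, ← hwt]; ring
  · rcases hc with rfl | rfl
    · simpa using hl
    · simp only [level_cons_three]; omega

/-! ### Splitting off the first letter -/

/-- The right-hand side splits as the `i = 0` terms plus the shifted right-hand side. [folklore] -/
theorem rhs_cons (r : ℕ) (x : List ℕ) (c : ℕ) (w : List ℕ) :
    W.rhs r x (c :: w) = (W.gK1 r x (c :: w) 0 - W.gK2 r x (c :: w) 0 + W.gT1 r x (c :: w) 0 -
      W.gT2 r x (c :: w) 0) + W.rhs r (x ++ [c]) w := by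
  rw [rhs, rhs, List.length_cons, Finset.sum_range_succ', add_comm]
  congr 1
  refine Finset.sum_congr rfl fun i _ => ?_
  have hK : K1 (c :: w) r (i + 1) ↔ K1 w r i := by
    simp only [K1, vK, List.length_cons, List.drop_succ_cons]; omega
  have hq : x ++ qK (c :: w) r (i + 1) = (x ++ [c]) ++ qK w r i := by
    simp [qK, Nat.add_right_comm i 1 r]
  have hT1 : T1 (c :: w) r (i + 1) ↔ T1 w r i := by simp [T1]
  have hT2 : T2 (c :: w) r (i + 1) ↔ T2 w r i := by simp [T2]
  have hqT : x ++ qT (c :: w) r (i + 1) = (x ++ [c]) ++ qT w r i := by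
    simp [qT, show i + 1 + r + 1 = (i + r + 1) + 1 by omega]
  have hv : vK (c :: w) r (i + 1) = vK w r i := rfl
  simp only [gK1, gK2, gT1, gT2, hK, hq, hT1, hT2, hqT, hv, List.length_cons,
    show i + 1 + r < w.length + 1 ↔ i + r < w.length by omega]

/-- The left-hand side splits as the windows at `p < |ρ(c)|` plus the shifted left-hand side. [folklore] -/
theorem lhs_cons {r : ℕ} (x : List ℕ) {c : ℕ} (hc : 2 ≤ c) (w : List ℕ) :
    W.lhs r x (c :: w) =
      ∑ p ∈ Finset.range (min ((rho (c :: w)).length + 1 - (2 * r + 1)) c), W.wterm r x (rho (c :: w)) p +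
        W.lhs r (x ++ [c]) w := by
  set n := 2 * r + 1 with hn
  set M := (rho (c :: w)).length + 1 - n with hM
  set L := (rho w).length + 1 - n with hL
  have hlen : (rho (c :: w)).length = c + (rho w).length := by
    rw [rho_cons, List.length_append, length_rhoLetter (by omega)]
  have hML : M = min M c + L := by
    simp only [hM, hL, hlen]; omega
  rw [lhs, lhs, ← hM, ← hL]
  conv_lhs => rw [hML, Finset.sum_range_add]
  congr 1
  refine Finset.sum_congr rfl fun i hi => ?_
  have hi' : i < L := Finset.mem_range.1 hi
  have hmin : min M c = c := by simp only [hM, hL, hlen] at hi' ⊢; omega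
  rw [hmin]
  -- the shift
  obtain ⟨L', hL'c, hρL⟩ : ∃ L' : List Bool, c = L'.length + 1 ∧ rhoLetter c = L' ++ [false] :=
    ⟨true :: List.replicate (c - 2) false, by simp; omega, rhoLetter_eq_append_false hc⟩
  rw [wterm, wterm, rho_cons, hρL, show c + i = i + (L'.length + 1) by omega, lft_shift, rgt_shift,
    inner_shift, quot_shift, rho_append, rho_cons, rho_nil, List.append_nil, hρL]
  simp only [List.append_assoc]

end WindowData

namespace WindowData

variable (W : WindowData)

/-! ### The window at `p = 0` (type (3), first kind, or nothing) -/

/-- The window `(0; a₁ ⋯ a_n; a_{n+1})`: it is `ζᵐ(v)` for the prefix `v` of `w` of weight `n` when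
`a_{n+1} = 1`, contributing `c_v ζᵐ(x u)` if `deg₃ v = 1` and a lower-level term if `deg₃ v ≥ 2`, and
it vanishes by I0 when `a_{n+1} = 0`. [cite: Brown2012, proof of Theorem 6.1] -/
theorem wterm_zero_sub_gK1_mem {w : List ℕ} (hw : IsHoffman w) {r : ℕ} (hr : 1 ≤ r) (x : List ℕ) :
    (if 0 < (rho w).length + 1 - (2 * r + 1) then W.wterm r x (rho w) 0 else 0) - W.gK1 r x w 0 ∈
      W.P r x w := by
  set n := 2 * r + 1 with hn
  have hlen := length_rho hw
  -- `gK1 ≠ 0` forces the prefix `w↾r` to have weight `n`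
  have hK1wt : K1 w r 0 → weight (w.take r) = n ∧ r ≤ w.length := by
    rintro ⟨hrle, hl1⟩
    simp only [vK, List.drop_zero, Nat.zero_add] at hrle hl1
    have := weight_eq_two_mul_length_add_level (hw.take r)
    rw [hl1, List.length_take, min_eq_left hrle] at this
    exact ⟨by omega, hrle⟩
  by_cases hle : n ≤ (rho w).length
  · rw [if_pos (by omega)]
    obtain ⟨k, j, hk, hkj, hj1, hj2⟩ := exists_block hw (m := n) (by rw [← hlen]; exact hle)
    rcases Nat.eq_zero_or_pos j with rfl | hjpos
    · -- `n` is a block boundary: the window is `ζᵐ(w↾k)`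
      rw [Nat.add_zero] at hkj
      have hv : IsHoffman (w.take k) := hw.take k
      have hinner : inner (rho w) n 0 = rho (w.take k) := by
        rw [inner_zero, ← hkj, take_rho_weight_take hw]
      have hquot : quot (rho w) n 0 = rho (w.drop k) := by
        rw [quot_zero, ← hkj, drop_rho_weight_take hw]
      have hrgt : rgt (rho w) n 0 = true := by
        rcases lt_or_eq_of_le hk with hk' | rfl
        · have h2 : 2 ≤ w[k] := two_le_of_isHoffman hw (List.getElem_mem hk')
          have hnlt : n < (rho w).length := by
            rw [hlen, ← hkj, ← weight_take_add_weight_drop w (k + 1), weight_take_succ hk']; omega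
          rw [rgt_of_lt (by simpa using hnlt)]
          have := getElem?_rho_weight_take_add hw hk' (j := 0) (by omega)
          rw [Nat.add_zero, hkj, List.getElem?_eq_getElem hnlt] at this
          simpa using this
        · exact rgt_of_eq (by rw [Nat.zero_add, hlen, ← hkj, List.take_length])
      have hwterm : W.wterm r x (rho w) 0 = W.B r (W.J (rho (w.take k))) (W.z (x ++ w.drop k)) := by
        rw [wterm, ← hn, lft_zero, hinner, hrgt, Im_false_true, hquot, z, rho_append]
      by_cases h1 : level (w.take k) = 1
      · -- type (3): `k = r`, the term is `gK1`
        have hkr : k = r := by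
          have := weight_eq_two_mul_length_add_level hv
          rw [hkj, h1, List.length_take, min_eq_left hk] at this
          omega
        subst hkr
        have hK : K1 w k 0 := ⟨by simpa using hk, by simpa [vK] using h1⟩
        have hg : W.gK1 k x w 0 = W.B k (W.J (rho (w.take k))) (W.z (x ++ w.drop k)) := by
          rw [gK1, if_pos hK]; simp [vK, qK]
        rw [hwterm, hg, sub_self]
        exact Submodule.zero_mem _
      · -- level `≥ 2`: a neglected term; and `gK1 = 0`
        have h2 : 2 ≤ level (w.take k) := by
          have hpar := weight_eq_two_mul_length_add_level hv
          rw [hkj] at hpar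
          rcases Nat.lt_or_ge (level (w.take k)) 2 with hlt | hge
          · interval_cases h : level (w.take k)
            · omega
            · exact absurd rfl h1
          · exact hge
        have hg : W.gK1 r x w 0 = 0 := by
          rw [gK1, if_neg]
          intro hK
          obtain ⟨hwr, hrle⟩ := hK1wt hK
          have := take_inj_of_weight_eq hw hrle hk (hwr.trans hkj.symm)
          subst this
          simp only [K1, vK, List.drop_zero] at hK
          exact h1 hK.2
        rw [hwterm, hg, sub_zero]
        refine W.B_z_mem_P _ (hw.drop k) ?_ ?_
        · have := weight_take_add_weight_drop w k; omega
        · have := level_take_add_level_drop w k; omega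
    · -- `n` strictly inside a block: `a_{n+1} = 0 = a_0`, the window vanishes by I0
      have hklt : k < w.length := lt_of_le_of_ne hk fun h => by have := hj2 h; omega
      have hjlt : j < w[k] := hj1 hklt
      have hnlt : n < (rho w).length := by
        rw [hlen, ← hkj, ← weight_take_add_weight_drop w (k + 1), weight_take_succ hklt]; omega
      have hrgt : rgt (rho w) n 0 = false := by
        rw [rgt_of_lt (by simpa using hnlt)]
        have := getElem?_rho_weight_take_add hw hklt hjlt
        rw [hkj, List.getElem?_eq_getElem hnlt] at this
        simp only [Option.some.injEq, Nat.zero_add] at this ⊢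
        rw [this]
        simp [hjpos.ne']
      have hwterm : W.wterm r x (rho w) 0 = 0 := by
        rw [wterm, ← hn, lft_zero, hrgt, Im_self _ _ (by
          rw [← List.length_pos_iff, length_inner (by simpa using hle)]; omega), map_zero,
          LinearMap.zero_apply]
      have hg : W.gK1 r x w 0 = 0 := by
        rw [gK1, if_neg]
        intro hK
        exact weight_take_ne hklt hjpos hjlt r ((hK1wt hK).1.trans hkj.symm)
      rw [hwterm, hg, sub_zero]
      exact Submodule.zero_mem _
  · rw [if_neg (by omega)]
    have hg : W.gK1 r x w 0 = 0 := by
      rw [gK1, if_neg]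
      intro hK
      have h1 := (hK1wt hK).1
      have h2 := weight_take_add_weight_drop w r
      omega
    rw [hg, sub_zero]
    exact Submodule.zero_mem _


/-! ### The window at `p = 1` (second kinds of types (2) and (3), or nothing) -/

/-- The window `(a₁; a₂ ⋯ a_{n+1}; a_{n+2})` when `n = |w↾k|` is a block boundary inside `w`: it is
`Iᵐ(1; σ 1; 0) = -ζᵐ(ṽ)` (`ρ(v) = 1σ`, `v = w↾k`, by I3), with quotient `ζᵐ(x u)`, `w = v u`.
[cite: Brown2012, proof of Theorem 6.1, case (3)] -/
theorem wterm_one_of_boundary {w : List ℕ} (hw : IsHoffman w) {k r : ℕ} (hk : k < w.length)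
    (hkn : weight (w.take k) = 2 * r + 1) (x : List ℕ) :
    1 < (rho w).length + 1 - (2 * r + 1) ∧
      W.wterm r x (rho w) 1 = -(W.B r (W.J (rho (w.take k).reverse)) (W.z (x ++ w.drop k))) := by
  set n := 2 * r + 1 with hn
  have hlen := length_rho hw
  have hv : IsHoffman (w.take k) := hw.take k
  have h2 : 2 ≤ w[k] := two_le_of_isHoffman hw (List.getElem_mem hk)
  have hwt : weight w = n + w[k] + weight (w.drop (k + 1)) := by
    rw [← weight_take_add_weight_drop w (k + 1), weight_take_succ hk, hkn]
  have hne : w.take k ≠ [] := by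
    intro h
    rw [h] at hkn
    simp [weight] at hkn
  have hne' : w.drop k ≠ [] := by simp; omega
  obtain ⟨t, ht⟩ := rho_eq_true_cons hne
  obtain ⟨t', ht'⟩ := rho_eq_true_cons hne'
  have htl : t.length = n - 1 := by
    have := length_rho hv
    rw [ht, hkn, List.length_cons] at this
    omega
  have hρ : rho w = true :: t ++ true :: t' := by
    rw [← ht, ← ht', ← rho_append, List.take_append_drop]
  refine ⟨by rw [hlen]; omega, ?_⟩
  have hlft : lft (rho w) 1 = true := CoactionData.lft_one (by rintro rfl; simp at hk)
  have hrgt : rgt (rho w) n 1 = false := by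
    rw [rgt_of_lt (by rw [hlen]; omega)]
    have := getElem?_rho_weight_take_add hw hk (j := 1) (by omega)
    rw [hkn, show n + 1 = 1 + n by omega, List.getElem?_eq_getElem (by rw [hlen]; omega)] at this
    simp only [Option.some.injEq] at this
    rw [this]
    simp
  have hinner : inner (rho w) n 1 = t ++ [true] := by
    rw [inner, hρ, List.cons_append, List.drop_succ_cons, List.drop_zero, List.take_append,
      List.take_of_length_le (by omega), htl, show n - (n - 1) = 1 by omega]
    simp
  have hquot : quot (rho w) n 1 = rho (w.drop k) := by
    rw [quot, hρ, ht', show 1 + n = (true :: t).length + 1 by simp [htl]; omega, List.drop_append,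
      List.take_append_of_le_length (by simp)]
    simp
  have hrev : rho (w.take k).reverse = true :: t.reverse := by
    rw [rho_reverse hne, ht, List.tail_cons]
  rw [wterm, ← hn, hlft, hrgt, hinner, Im_true_false, hquot, z, rho_append, hrev, map_smul,
    LinearMap.smul_apply, List.length_append, List.length_singleton, htl,
    show n - 1 + 1 = n by omega, show ((-1 : ℚ) ^ n) = -1 from Odd.neg_one_pow ⟨r, by omega⟩,
    List.reverse_append, List.reverse_singleton, List.singleton_append, neg_one_smul]

/-- The window `(a₁; a₂ ⋯ a_{n+1}; a_{n+2})` when `n - 1 = |w↾k|` is a block boundary followed by the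
letter `3`: it is `Iᵐ(1; σ 1 0; 0) = -Iᵐ(0; 0 1 σ̃; 1)` (by I3) with quotient `ζᵐ(x 2 y)`,
`w = v 3 y`. [cite: Brown2012, proof of Theorem 6.1, case (2)] -/
theorem wterm_one_of_boundary_three {w : List ℕ} (hw : IsHoffman w) {k r : ℕ} (hk : k < w.length)
    (hkn : weight (w.take k) + 1 = 2 * r + 1) (h3 : w[k] = 3) (hr : 1 ≤ r) (x : List ℕ) :
    1 < (rho w).length + 1 - (2 * r + 1) ∧
      W.wterm r x (rho w) 1 =
        -(W.B r (W.J (false :: rho (w.take k).reverse)) (W.z (x ++ 2 :: w.drop (k + 1)))) := by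
  set n := 2 * r + 1 with hn
  have hlen := length_rho hw
  have hv : IsHoffman (w.take k) := hw.take k
  have hwt : weight w = n + 2 + weight (w.drop (k + 1)) := by
    rw [← weight_take_add_weight_drop w (k + 1), weight_take_succ hk, h3]; omega
  have hne : w.take k ≠ [] := by
    intro h
    rw [h] at hkn
    simp [weight] at hkn
    omega
  obtain ⟨t, ht⟩ := rho_eq_true_cons hne
  have htl : t.length = n - 2 := by
    have := length_rho hv
    rw [ht, List.length_cons] at this
    omega
  have hρ : rho w = true :: t ++ (true :: false :: false :: rho (w.drop (k + 1))) := by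
    rw [CoactionData.rho_eq_take_letter_drop hk, ht, h3]
    rfl
  refine ⟨by rw [hlen]; omega, ?_⟩
  have hlft : lft (rho w) 1 = true := CoactionData.lft_one (by rintro rfl; simp at hk)
  have hrgt : rgt (rho w) n 1 = false := by
    rw [rgt_of_lt (by rw [hlen]; omega)]
    have := getElem?_rho_weight_take_add hw hk (j := 2) (by omega)
    rw [show weight (w.take k) + 2 = 1 + n by omega,
      List.getElem?_eq_getElem (by rw [hlen]; omega)] at this
    simp only [Option.some.injEq] at this
    rw [this]
    simp
  have hinner : inner (rho w) n 1 = t ++ [true, false] := by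
    rw [inner, hρ, List.cons_append, List.drop_succ_cons, List.drop_zero, List.take_append,
      List.take_of_length_le (by omega), htl, show n - (n - 2) = 2 by omega]
    simp
  have hquot : quot (rho w) n 1 = rho (2 :: w.drop (k + 1)) := by
    rw [quot, hρ, show 1 + n = (true :: t).length + 2 by simp [htl]; omega, List.drop_append,
      List.take_append_of_le_length (by simp)]
    simp [rhoLetter]
  have hrev : rho (w.take k).reverse = true :: t.reverse := by
    rw [rho_reverse hne, ht, List.tail_cons]
  rw [wterm, ← hn, hlft, hrgt, hinner, Im_true_false, hquot, z, rho_append, hrev, map_smul,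
    LinearMap.smul_apply, List.length_append, htl, show n - 2 + [true, false].length = n by simp; omega,
    show ((-1 : ℚ) ^ n) = -1 from Odd.neg_one_pow ⟨r, by omega⟩, List.reverse_append]
  simp

/-- **The window at `p = 1`.** It is the right neighbour `-c_{ṽ} ζᵐ(x u)` of the type-(3) window at
`p = 0` when `w = v u` with `deg₃ v = 1`, `|v| = 2r+1`, `u ≠ ∅`; it is `-c_{12^r} ζᵐ(x 2 y)` when
`w = 2^r 3 y` (type (2)); otherwise it vanishes (I0) or is a neglected lower-level term.
[cite: Brown2012, proof of Theorem 6.1, cases (2), (3)] -/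
theorem wterm_one_add_mem {w : List ℕ} (hw : IsHoffman w) {r : ℕ} (hr : 1 ≤ r) (x : List ℕ) :
    (if 1 < (rho w).length + 1 - (2 * r + 1) then W.wterm r x (rho w) 1 else 0) + W.gK2 r x w 0 +
      W.gT2 r x w 0 ∈ W.P r x w := by
  set n := 2 * r + 1 with hn
  have hlen := length_rho hw
  by_cases hA : K1 w r 0 ∧ 0 + r < w.length
  · -- type (3), second kind, neighbour of the window at `0`
    obtain ⟨⟨hrle, hl1⟩, hrlt⟩ := hA
    simp only [vK, List.drop_zero, Nat.zero_add] at hrle hl1 hrlt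
    have hwt : weight (w.take r) = n := by
      have := weight_eq_two_mul_length_add_level (hw.take r)
      rw [hl1, List.length_take, min_eq_left hrle] at this
      omega
    obtain ⟨hwin, hwterm⟩ := W.wterm_one_of_boundary hw hrlt hwt x
    rw [if_pos hwin, hwterm]
    have hg2 : W.gK2 r x w 0 = W.B r (W.J (rho (w.take r).reverse)) (W.z (x ++ w.drop r)) := by
      rw [gK2, if_pos ⟨⟨by simpa using hrle, by simpa [vK] using hl1⟩, by simpa using hrlt⟩]
      simp [vK, qK]
    have hgT : W.gT2 r x w 0 = 0 := by
      rw [gT2, if_neg]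
      intro hT
      have h := congrArg (List.take r) hT
      rw [List.drop_zero, List.take_take, min_eq_left (Nat.le_succ r), List.take_left' (by simp)] at h
      rw [h, level_replicate_two] at hl1
      exact absurd hl1 (by norm_num)
    rw [hg2, hgT, add_zero, neg_add_cancel]
    exact Submodule.zero_mem _
  · by_cases hB : T2 w r 0
    · -- type (2), second kind: `w = 2^r 3 y`
      have hT : w.take (r + 1) = List.replicate r 2 ++ [3] := by simpa [T2] using hB
      have hrlt : r < w.length := by
        have := congrArg List.length hT
        simp at this
        omega
      have htake : w.take r = List.replicate r 2 := by
        have h := congrArg (List.take r) hT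
        rwa [List.take_take, min_eq_left (Nat.le_succ r), List.take_left' (by simp)] at h
      have h3 : w[r] = 3 := by
        have h := List.getElem_take' (xs := w) (i := r) (j := r + 1) (hi := hrlt) (hj := Nat.lt_succ_self r)
        rw [h]
        simp [hT]
      have hwt : weight (w.take r) + 1 = n := by
        rw [htake]
        simp [weight]
        omega
      obtain ⟨hwin, hwterm⟩ := W.wterm_one_of_boundary_three hw hrlt hwt h3 hr x
      rw [if_pos hwin, hwterm]
      have hg2 : W.gK2 r x w 0 = 0 := by
        rw [gK2, if_neg]
        rintro ⟨⟨-, hl1⟩, -⟩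
        simp [vK, htake] at hl1
      have hgT : W.gT2 r x w 0 =
          W.B r (W.J (false :: rho (List.replicate r 2))) (W.z (x ++ 2 :: w.drop (r + 1))) := by
        rw [gT2, if_pos hB]
        simp [qT]
      rw [hg2, hgT, add_zero, htake, List.reverse_replicate, neg_add_cancel]
      exact Submodule.zero_mem _
    · -- nothing, or a neglected term
      have hg2 : W.gK2 r x w 0 = 0 := by rw [gK2, if_neg hA]
      have hgT : W.gT2 r x w 0 = 0 := by rw [gT2, if_neg hB]
      rw [hg2, hgT, add_zero, add_zero]
      by_cases hwin : 1 < (rho w).length + 1 - n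
      · rw [if_pos hwin]
        have hwne : w ≠ [] := by
          rintro rfl
          rw [rho_nil, List.length_nil] at hwin
          omega
        have hlft : lft (rho w) 1 = true := CoactionData.lft_one hwne
        have hin : inner (rho w) n 1 ≠ [] := by
          rw [← List.length_pos_iff, length_inner (by omega)]; omega
        rcases Nat.lt_or_ge (n + 1) (rho w).length with hlt | hge
        · obtain ⟨k, j, hk, hkj, hj1, hj2⟩ := exists_block hw (m := n + 1) (by rw [← hlen]; omega)
          have hklt : k < w.length := lt_of_le_of_ne hk fun h => by
            have := hj2 h
            subst h
            rw [List.take_length] at hkj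
            omega
          have hjlt := hj1 hklt
          have hwk : w[k] ≤ 3 := by rcases hw _ (List.getElem_mem hklt) with h | h <;> omega
          have hget := getElem?_rho_weight_take_add hw hklt hjlt
          rw [hkj, show n + 1 = 1 + n by omega, List.getElem?_eq_getElem (by omega)] at hget
          simp only [Option.some.injEq] at hget
          rcases j with _ | _ | _ | j
          · -- `a_{n+2} = 1 = a_1`: vanishes
            have hrgt : rgt (rho w) n 1 = true := by
              rw [rgt_of_lt (by omega), hget]; simp
            rw [wterm, ← hn, hlft, hrgt, Im_self _ _ hin, map_zero, LinearMap.zero_apply]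
            exact Submodule.zero_mem _
          · -- boundary at `n`, `deg₃ (w↾k) ≥ 2`
            have hkn : weight (w.take k) = n := by omega
            have hpar := weight_eq_two_mul_length_add_level (hw.take k)
            rw [hkn, List.length_take, min_eq_left hk] at hpar
            have hne1 : level (w.take k) ≠ 1 := by
              intro h1
              apply hA
              have hkr : k = r := by omega
              subst hkr
              exact ⟨⟨by simpa using hk, by simpa [vK] using h1⟩, by simpa using hklt⟩
            have h2 : 2 ≤ level (w.take k) := by omega
            obtain ⟨-, hwterm⟩ := W.wterm_one_of_boundary hw hklt hkn x
            rw [hwterm]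
            refine Submodule.neg_mem _ (W.B_z_mem_P _ (hw.drop k) ?_ ?_)
            · have := weight_take_add_weight_drop w k; omega
            · have := level_take_add_level_drop w k; omega
          · -- boundary at `n - 1` followed by `3`, `deg₃ (w↾k) ≥ 2`
            have h3 : w[k] = 3 := by omega
            have hkn : weight (w.take k) + 1 = n := by omega
            have hpar := weight_eq_two_mul_length_add_level (hw.take k)
            rw [List.length_take, min_eq_left hk] at hpar
            have hne0 : level (w.take k) ≠ 0 := by
              intro h0
              apply hB
              have hkr : k = r := by omega
              subst hkr
              have htk := eq_replicate_two_of_level_eq_zero (hw.take k) h0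
              rw [List.length_take, min_eq_left hk] at htk
              show (w.drop 0).take (k + 1) = _
              rw [List.drop_zero, List.take_succ_eq_append_getElem hklt, htk, h3]
            have h2 : 2 ≤ level (w.take k) := by omega
            obtain ⟨-, hwterm⟩ := W.wterm_one_of_boundary_three hw hklt hkn h3 hr x
            rw [hwterm]
            refine Submodule.neg_mem _ (W.B_z_mem_P _ (u := 2 :: w.drop (k + 1))
              (fun i hi => ?_) ?_ ?_)
            · simp only [List.mem_cons] at hi
              rcases hi with rfl | hi
              · exact Or.inl rfl
              · exact hw.drop (k + 1) i hi
            · have := weight_take_add_weight_drop w (k + 1)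
              rw [weight_take_succ hklt, h3] at this
              rw [weight_cons]
              omega
            · have := level_take_add_level_drop w (k + 1)
              rw [List.take_succ_eq_append_getElem hklt, h3, level_append, level_cons_three] at this
              simp only [level_cons_two]
              have h0 : level ([] : List ℕ) = 0 := rfl
              omega
          · omega
        · -- `a_{n+2}` is the final `1`: vanishes
          have hrgt : rgt (rho w) n 1 = true := rgt_of_eq (by omega)
          rw [wterm, ← hn, hlft, hrgt, Im_self _ _ hin, map_zero, LinearMap.zero_apply]
          exact Submodule.zero_mem _
      · rw [if_neg hwin]
        exact Submodule.zero_mem _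

/-! ### The window at `p = 2` for a word starting with `3` (type (2), first kind, or nothing) -/

/-- **The window at `p = 2` of `(0; 100 ρ(w'); 1)`.** It is `Iᵐ(0; 0 ρ(2^r); 1) = ζᵐ₁(2^r)`,
contributing `c_{12^r} ζᵐ(x 2 y)`, when `w' = 2^r y`; otherwise it vanishes or is neglected.
[cite: Brown2012, proof of Theorem 6.1, case (2)] -/
theorem wterm_two_sub_gT1_mem {w : List ℕ} (hw : IsHoffman (3 :: w)) {r : ℕ} (hr : 1 ≤ r)
    (x : List ℕ) :
    (if 2 < (rho (3 :: w)).length + 1 - (2 * r + 1) then W.wterm r x (rho (3 :: w)) 2 else 0) -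
      W.gT1 r x (3 :: w) 0 ∈ W.P r x (3 :: w) := by
  set n := 2 * r + 1 with hn
  have hw' : IsHoffman w := fun i hi => hw i (by simp [hi])
  have hlen := length_rho hw'
  have hρ : rho (3 :: w) = [true, false, false] ++ rho w := rfl
  have hlen3 : (rho (3 :: w)).length = weight w + 3 := by rw [hρ, List.length_append, hlen]; simp; omega
  -- `gT1 ≠ 0` means `w↾r = 2^r`
  have hT1 : T1 (3 :: w) r 0 ↔ r ≤ w.length ∧ w.take r = List.replicate r 2 := by
    simp only [T1, List.drop_zero, List.take_succ_cons, List.cons.injEq, true_and]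
    constructor
    · intro h
      have := congrArg List.length h
      simp at this
      exact ⟨by omega, h⟩
    · exact fun h => h.2
  by_cases hwin : 2 < (rho (3 :: w)).length + 1 - n
  · rw [if_pos hwin]
    have h2r : 2 * r ≤ weight w := by rw [hlen3] at hwin; omega
    obtain ⟨k, j, hk, hkj, hj1, hj2⟩ := exists_block hw' h2r
    have hlft : lft (rho (3 :: w)) 2 = false := by
      rw [show (2 : ℕ) = 1 + 1 from rfl, lft_succ (by rw [hlen3]; omega)]; rfl
    have hinner : inner (rho (3 :: w)) n 2 = false :: (rho w).take (2 * r) := by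
      rw [inner, hρ]; simp [hn]
    have hquot : quot (rho (3 :: w)) n 2 = rhoLetter 2 ++ (rho w).drop (2 * r) := by
      rw [quot, hρ, show 2 + n = [true, false, false].length + 2 * r by simp; omega, List.drop_append]
      simp [rhoLetter]
    rcases Nat.eq_zero_or_pos j with rfl | hjpos
    · -- boundary of `w` at `2r`
      rw [Nat.add_zero] at hkj
      have hv : IsHoffman (w.take k) := hw'.take k
      have hrgt : rgt (rho (3 :: w)) n 2 = true := by
        rcases lt_or_eq_of_le hk with hk' | rfl
        · have h2 : 2 ≤ w[k] := two_le_of_isHoffman hw' (List.getElem_mem hk')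
          have hlt : 2 * r < (rho w).length := by
            rw [hlen, ← hkj, ← weight_take_add_weight_drop w (k + 1), weight_take_succ hk']; omega
          rw [rgt_of_lt (by rw [hlen3]; omega)]
          have := getElem?_rho_weight_take_add hw' hk' (j := 0) (by omega)
          rw [Nat.add_zero, hkj, List.getElem?_eq_getElem hlt] at this
          simp only [Option.some.injEq] at this
          rw [show (rho (3 :: w))[2 + n] = (rho w)[2 * r] by
            simp only [hρ]; rw [List.getElem_append_right (by simp; omega)]; congr 1; simp; omega]
          simpa using this
        · exact rgt_of_eq (by rw [List.take_length] at hkj; rw [hlen3]; omega)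
      have hwterm : W.wterm r x (rho (3 :: w)) 2 =
          W.B r (W.J (false :: rho (w.take k))) (W.z (x ++ 2 :: w.drop k)) := by
        rw [wterm, ← hn, hlft, hrgt, hinner, Im_false_true, hquot, ← hkj, take_rho_weight_take hw',
          drop_rho_weight_take hw', z, rho_append, rho_cons]
      by_cases h0 : level (w.take k) = 0
      · -- `w↾k = 2^r`: the term is `gT1`
        have hpar := weight_eq_two_mul_length_add_level hv
        rw [hkj, h0, List.length_take, min_eq_left hk] at hpar
        have hkr : k = r := by omega
        subst hkr
        have htk := eq_replicate_two_of_level_eq_zero hv h0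
        rw [List.length_take, min_eq_left hk] at htk
        have hg : W.gT1 k x (3 :: w) 0 =
            W.B k (W.J (false :: rho (List.replicate k 2))) (W.z (x ++ 2 :: w.drop k)) := by
          rw [gT1, if_pos (hT1.2 ⟨hk, htk⟩)]
          simp [qT]
        rw [hwterm, hg, htk, sub_self]
        exact Submodule.zero_mem _
      · have hpar := weight_eq_two_mul_length_add_level hv
        rw [hkj, List.length_take, min_eq_left hk] at hpar
        have h2 : 2 ≤ level (w.take k) := by omega
        have hg : W.gT1 r x (3 :: w) 0 = 0 := by
          rw [gT1, if_neg]
          intro hT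
          obtain ⟨hrle, htk⟩ := hT1.1 hT
          have hwr : weight (w.take r) = 2 * r := by rw [htk]; simp [weight, mul_comm]
          have := take_inj_of_weight_eq hw' hrle hk (hwr.trans hkj.symm)
          subst this
          rw [htk, level_replicate_two] at h0
          exact h0 rfl
        rw [hwterm, hg, sub_zero]
        refine W.B_z_mem_P _ (u := 2 :: w.drop k) (fun i hi => ?_) ?_ ?_
        · simp only [List.mem_cons] at hi
          rcases hi with rfl | hi
          · exact Or.inl rfl
          · exact hw'.drop k i hi
        · have := weight_take_add_weight_drop w k
          rw [weight_cons, weight_cons]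
          omega
        · have := level_take_add_level_drop w k
          simp only [level_cons_two, level_cons_three]
          omega
    · -- `2r` strictly inside a block of `w`: vanishes; `gT1 = 0`
      have hklt : k < w.length := lt_of_le_of_ne hk fun h => by have := hj2 h; omega
      have hjlt : j < w[k] := hj1 hklt
      have hlt : 2 * r < (rho w).length := by
        rw [hlen, ← hkj, ← weight_take_add_weight_drop w (k + 1), weight_take_succ hklt]; omega
      have hrgt : rgt (rho (3 :: w)) n 2 = false := by
        rw [rgt_of_lt (by rw [hlen3]; omega)]
        have := getElem?_rho_weight_take_add hw' hklt hjlt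
        rw [hkj, List.getElem?_eq_getElem hlt] at this
        simp only [Option.some.injEq] at this
        rw [show (rho (3 :: w))[2 + n] = (rho w)[2 * r] by
          simp only [hρ]; rw [List.getElem_append_right (by simp; omega)]; congr 1; simp; omega, this]
        simp [hjpos.ne']
      have hwterm : W.wterm r x (rho (3 :: w)) 2 = 0 := by
        rw [wterm, ← hn, hlft, hrgt, Im_self _ _ (by rw [hinner]; simp), map_zero, LinearMap.zero_apply]
      have hg : W.gT1 r x (3 :: w) 0 = 0 := by
        rw [gT1, if_neg]
        intro hT
        obtain ⟨hrle, htk⟩ := hT1.1 hT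
        have hwr : weight (w.take r) = 2 * r := by rw [htk]; simp [weight, mul_comm]
        exact weight_take_ne hklt hjpos hjlt r (hwr.trans hkj.symm)
      rw [hwterm, hg, sub_zero]
      exact Submodule.zero_mem _
  · rw [if_neg hwin]
    have hg : W.gT1 r x (3 :: w) 0 = 0 := by
      rw [gT1, if_neg]
      intro hT
      obtain ⟨hrle, htk⟩ := hT1.1 hT
      have hwr : weight (w.take r) = 2 * r := by rw [htk]; simp [weight, mul_comm]
      have := weight_take_add_weight_drop w r
      rw [hlen3] at hwin
      omega
    rw [hg, sub_zero]
    exact Submodule.zero_mem _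

/-- For a word starting with `2` there is no type-(2) window of the first kind at position `0`. [folklore] -/
theorem gT1_two_cons (r : ℕ) (x w : List ℕ) : W.gT1 r x (2 :: w) 0 = 0 := by
  rw [gT1, if_neg]
  simp [T1]

/-! ### Theorem 6.1 (word-level form): `D_{2r+1} ζᵐ(w)` modulo lower levels -/

/-- **Brown 2012, Theorem 6.1 with Lemmas 5.5, 5.6, word-level form with FORMAL coefficients**
(module-valued pairing `B`; Brown's `∂^f`). For a Hoffman word
`w` and `r ≥ 1`, the `ζ_{2r+1}`-component of `D_{2r+1} ζᵐ(x·w)`-with-`x`-frozen, i.e. (3.4) summed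
over the windows of `(0; ρ(w); 1)` with quotients prefixed by `ρ(x)`, equals
`∑_{w = uvy, deg₃ v = 1, |v| = 2r+1} (c_v - [y ≠ ∅] c_{ṽ}) ζᵐ(xuy) + ∑_{w = u 3 2^r y} c_{12^r} ζᵐ(xu2y)
 - ∑_{w = u 2^r 3 y} c_{12^r} ζᵐ(xu2y)` modulo the `ζᵐ(xu')` with `deg₃ u' ≤ deg₃ w - 2`
(by induction on `w`, peeling off the first letter: the windows not starting inside the first block
are the windows of the rest). [cite: Brown2012, Theorem 6.1, Lemmas 5.5–5.6] -/
theorem lhs_sub_rhs_mem {r : ℕ} (hr : 1 ≤ r) {w : List ℕ} (hw : IsHoffman w) (x : List ℕ) :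
    W.lhs r x w - W.rhs r x w ∈ W.P r x w := by
  induction w generalizing x with
  | nil =>
    have h1 : W.lhs r x [] = 0 := by
      rw [lhs, rho_nil, List.length_nil, show 0 + 1 - (2 * r + 1) = 0 by omega, Finset.sum_range_zero]
    have h2 : W.rhs r x [] = 0 := by
      rw [rhs, List.length_nil, Finset.sum_range_one, gK1, gK2, gT1, gT2, if_neg, if_neg, if_neg, if_neg]
      · simp
      · simp [T2]
      · simp [T1]
      · rintro ⟨⟨h, -⟩, -⟩; simp at h; omega
      · rintro ⟨h, -⟩; simp at h; omega
    rw [h1, h2, sub_zero]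
    exact Submodule.zero_mem _
  | cons c w ih =>
    have hc : c = 2 ∨ c = 3 := hw c (by simp)
    have hw' : IsHoffman w := fun i hi => hw i (by simp [hi])
    have hP := W.P_append_le x hc (ih hw' (x ++ [c]))
    have e0 := W.wterm_zero_sub_gK1_mem hw hr x
    have e1 := W.wterm_one_add_mem hw hr x
    rw [W.lhs_cons x (by omega) w, W.rhs_cons]
    rcases hc with rfl | rfl
    · rw [sum_range_min_two, W.gT1_two_cons]
      convert Submodule.add_mem _ (Submodule.add_mem _ e0 e1) hP using 1
      abel
    · rw [sum_range_min_three]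
      have e2 := W.wterm_two_sub_gT1_mem hw hr x
      have hT2 : W.gT2 r x (3 :: w) 0 = 0 := by
        rw [gT2, if_neg]
        simp only [T2, List.drop_zero, List.take_succ_cons]
        cases r with
        | zero => omega
        | succ r => simp [List.replicate_succ]
      rw [hT2] at e1
      convert Submodule.add_mem _ (Submodule.add_mem _ (Submodule.add_mem _ e0 e1) e2) hP using 1
      rw [hT2]
      abel


/-! ### Exactness in level `≤ 1` (Lemmas 3.4, 3.5) -/

/-- In level `≤ 1` nothing is neglected: `P = ⊥`. [folklore] -/
theorem P_eq_bot_of_level_le_one {r : ℕ} (x : List ℕ) {w : List ℕ} (hw : level w ≤ 1) :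
    W.P r x w = ⊥ := by
  rw [P, Submodule.span_eq_bot]
  rintro _ ⟨h, u, -, -, hl, rfl⟩
  omega

/-- **Exact window formula in level `≤ 1`** (the shape of Brown's Lemma 3.5): for `deg₃ w ≤ 1` the
left-hand side EQUALS the formal right-hand side. [cite: Brown2012, Lemma 3.5] -/
theorem lhs_eq_rhs_of_level_le_one {r : ℕ} (hr : 1 ≤ r) {w : List ℕ} (hw : IsHoffman w)
    (hl : level w ≤ 1) (x : List ℕ) : W.lhs r x w = W.rhs r x w := by
  have h := W.lhs_sub_rhs_mem hr hw x
  rw [W.P_eq_bot_of_level_le_one x hl, Submodule.mem_bot, sub_eq_zero] at h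
  exact h

/-- In level `0` the formal right-hand side vanishes (no factor contains a `3`). [folklore] -/
theorem rhs_eq_zero_of_level_eq_zero (r : ℕ) {w : List ℕ} (hw : IsHoffman w)
    (hl : level w = 0) (x : List ℕ) : W.rhs r x w = 0 := by
  have hw2 := eq_replicate_two_of_level_eq_zero hw hl
  refine Finset.sum_eq_zero fun i _ => ?_
  have h3 : (3 : ℕ) ∉ w := fun h => by
    rw [hw2] at h
    have := List.eq_of_mem_replicate h
    omega
  rw [gK1, gK2, gT1, gT2, if_neg, if_neg, if_neg, if_neg]
  · simp
  · intro h
    apply h3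
    have : 3 ∈ (w.drop i).take (r + 1) := by rw [T2] at h; rw [h]; simp
    exact List.mem_of_mem_drop (List.mem_of_mem_take this)
  · intro h
    apply h3
    have : 3 ∈ (w.drop i).take (r + 1) := by rw [T1] at h; rw [h]; simp
    exact List.mem_of_mem_drop (List.mem_of_mem_take this)
  · rintro ⟨⟨-, h1⟩, -⟩
    apply h3
    have : 3 ∈ vK w r i := List.count_pos_iff.1 (by rw [level] at h1; omega)
    exact List.mem_of_mem_drop (List.mem_of_mem_take this)
  · rintro ⟨-, h1⟩
    apply h3
    have : 3 ∈ vK w r i := List.count_pos_iff.1 (by rw [level] at h1; omega)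
    exact List.mem_of_mem_drop (List.mem_of_mem_take this)

/-- **Brown 2012, Lemma 3.4 (coaction part), formal version**: every window of `(0; (10)^n; 1)` of
odd inner length has equal endpoints, so the left-hand side vanishes for `w = 2^n` (and any prefix
`x`): `D_{2r+1} ζᵐ(2^{n}) = 0`. [cite: Brown2012, Lemma 3.4] -/
theorem lhs_eq_zero_of_level_eq_zero {r : ℕ} (hr : 1 ≤ r) {w : List ℕ} (hw : IsHoffman w)
    (hl : level w = 0) (x : List ℕ) : W.lhs r x w = 0 := by
  rw [W.lhs_eq_rhs_of_level_le_one hr hw (by omega) x, W.rhs_eq_zero_of_level_eq_zero r hw hl x]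

/-- `D r (ζᵐ(2^n)) = 0`. [cite: Brown2012, Lemma 3.4] -/
theorem D_z_replicate_two {r : ℕ} (hr : 1 ≤ r) (n : ℕ) : W.D r (W.z (List.replicate n 2)) = 0 := by
  rw [W.D_z_eq_lhs hr, W.lhs_eq_zero_of_level_eq_zero hr (isHoffman_replicate_two n)
    (level_replicate_two n)]

end WindowData

/-! ### The scalar case: `CoactionData` as window data -/

namespace CoactionData

variable (C : CoactionData)

/-- The `ζ_{2r+1}`-component as window data: `T r = H`, `B r h y = f r (h) • y`.
[cite: Brown2012, Definition 5.7] -/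
abbrev toWindowData : WindowData where
  H := C.H
  J := C.J
  T := fun _ => C.H
  B := fun r => (LinearMap.lsmul ℚ C.H).comp (C.f r)
  D := C.D
  coaction := fun r hr v => by
    rw [C.coaction r hr v]
    rfl

/-- The pairing of the scalar case. [folklore] -/
@[simp] theorem toWindowData_B (r : ℕ) (h y : C.H) : C.toWindowData.B r h y = C.f r h • y := rfl

/-- The left-hand sides agree. [folklore] -/
theorem toWindowData_lhs (r : ℕ) (x w : List ℕ) : C.toWindowData.lhs r x w = C.lhs r x w := rfl

/-- **Consistency with `BrownCoactionCalculus`**: specializing the formal coefficients by (3.12)/(4.2)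
(`f r ζᵐ(v) = c_v`) and Lemma 3.8 (`f r ζᵐ₁(2^r) = 2(-1)^r`) turns the formal right-hand side into
the specialized one (`μ : C_w ↦ c_w` of (5.8)). [cite: Brown2012, §5.4 (5.8)] -/
theorem rhs_toWindowData {r : ℕ} (hr : 1 ≤ r) (x : List ℕ) {w : List ℕ} (hw : IsHoffman w) :
    C.toWindowData.rhs r x w = C.rhs r x w := by
  refine Finset.sum_congr rfl fun i _ => ?_
  have hv : IsHoffman (vK w r i) := (hw.drop i).take r
  have e1 : C.toWindowData.gK1 r x w i = C.gK1 r x w i := by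
    by_cases h : K1 w r i
    · rw [WindowData.gK1, gK1, if_pos h, if_pos h]
      show C.f r (C.J (rho (vK w r i))) • C.z (x ++ qK w r i) = _
      rw [C.f_J_rho_of_level_one hv h.2 (by
        rw [vK, List.length_take, List.length_drop, min_eq_left (by have := h.1; omega)])]
    · rw [WindowData.gK1, gK1, if_neg h, if_neg h]
  have e2 : C.toWindowData.gK2 r x w i = C.gK2 r x w i := by
    by_cases h : K1 w r i ∧ i + r < w.length
    · rw [WindowData.gK2, gK2, if_pos h, if_pos h]
      show C.f r (C.J (rho (vK w r i).reverse)) • C.z (x ++ qK w r i) = _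
      rw [C.f_J_rho_of_level_one hv.reverse (by rw [level_reverse]; exact h.1.2) (by
        rw [List.length_reverse, vK, List.length_take, List.length_drop,
          min_eq_left (by have := h.1.1; omega)])]
    · rw [WindowData.gK2, gK2, if_neg h, if_neg h]
  have e3 : C.toWindowData.gT1 r x w i = C.gT1 r x w i := by
    by_cases h : T1 w r i
    · rw [WindowData.gT1, gT1, if_pos h, if_pos h]
      show C.f r (C.J (false :: rho (List.replicate r 2))) • C.z (x ++ qT w r i) = _
      rw [C.f_zetaOne r hr]
    · rw [WindowData.gT1, gT1, if_neg h, if_neg h]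
  have e4 : C.toWindowData.gT2 r x w i = C.gT2 r x w i := by
    by_cases h : T2 w r i
    · rw [WindowData.gT2, gT2, if_pos h, if_pos h]
      show C.f r (C.J (false :: rho (List.replicate r 2))) • C.z (x ++ qT w r i) = _
      rw [C.f_zetaOne r hr]
    · rw [WindowData.gT2, gT2, if_neg h, if_neg h]
  rw [e1, e2, e3, e4]

end CoactionData

end Brown2012

end Literature.NumberTheory.Transcendental
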